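import Summits.CriticalPhenomena.PercolationContinuityZ3.Theorems.PercShatteringRaceNearLinearTwoClusterDecayStubAspectOfTwoArmBdry
import HarnessLib

/-!
# Crux `PercShatteringRace.NearLinearTwoClusterDecay` (stmt-CriticalPhenomena-5785) — stub V6 `stub_aspectOfTwoArmBdryWide`

Helper file of the line `pair-decay-long-arms-dense` (§ Point-to-point frontier); lands with
`--supports stmt-CriticalPhenomena-5785` (registered stub `stub_aspectOfTwoArmBdryWide`).

## Statement

W5 (`stub_aspectOfTwoArmBdry`) with the WIDE connection box `Λ_{9n}` (van den Berg–Don's box) in place of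
`Λ_{2n}`: for bond percolation on `ℤ³` at a parameter `p > 0`, a pair-connection lower bound
`P_p(a ↔ b inside Λ_{9n}) ≥ c n^{-e}` on `Λ_n²` (`n ≥ 1`, `e ≥ 0`) and a two-arms exponent `κ > 0`
(`P_p(edgeTwoArms i m) ≤ C m^{-κ}`, `m ≥ 1`) give, for every aspect exponent `A > 1` with `κ A > 10 + e`,
that the crux event at exponent `A` — two sites of `Λ_n` each joined inside `Λ_N` to `∂ⁱⁿΛ_N` but not to
each other, `N = ⌈n^A⌉` — has probability tending to `0`.

## Proof sketch

Write `N = ⌈n^A⌉₊`, `P = P_p`.  Everything except the middle box is W5's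
(`NearLinearTwoClusterDecayAspectBdry`, imported):
* the crux event of `(Λ_n, Λ_N)` lies in `⋃_{a, b ∈ ∂ⁱⁿΛ_n} twoArmsBox n (N − n) a b`; the union bound,
  Cerf 2015 Lemma 7.1 (bond, `AKN.real_twoArmsBox_mul_le`) with middle box `Λ_{n+k}`, `k = 8n`
  (connection box `Λ_{9n}`), the division by `δ = c n^{-e}` and the count are W5's
  `real_twoCluster_le_poly` at middle radius `m = 9n` (stated there for a general `n ≤ m`, `m + 3 ≤ N`):
  `P(crux event) ≤ 36 (2n+1)⁴ (1 + 6/p) (18n+3)⁶ · 3C (N − 9n − 2)^{−κ} / (c n^{−e})` once `9n + 3 ≤ N`;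
* real analysis: W5's `poly_bound_bdry` with `P = 9n` needs `72 n ≤ n^A`, eventually true as `A > 1`
  (`eventually_one_le_and_seventyTwo_mul_le`: W3's argument with the constant `72`), whence
  `9n + 3 ≤ N` and `N − 9n − 2 ≥ n^A / 2`; collecting the powers (`collect_rpow_bdry_wide`, the factor
  `(9n)⁶` contributing `9⁶`) the bound is `≤ K n^{10 + e − κA} → 0` as `κA > 10 + e`
  (`tendsto_rpow_neg_atTop`, `squeeze_zero'`).

## References

* R. Cerf, *A lower bound on the two-arms exponent for critical percolation on the lattice*, Ann. Probab. 43
  (2015), §7, Lemma 7.1, Corollary 7.2 and Remark (ii) (arXiv:1306.3105 pp. 11–13) [Cerf2015].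
* J. van den Berg, H. Don, *A lower bound for point-to-point connection probabilities in critical
  percolation*, Electron. Commun. Probab. 25 (2020) (arXiv:1912.10964), Thm 1 / Cor 2 (the box `Λ_{9n}`).
-/

noncomputable section

namespace Summit.CriticalPhenomena.PercolationContinuityZ3.Theorems

namespace NearLinearTwoClusterDecayAspectBdryWide

open MeasureTheory Filter Topology
open Literature.Probability.LatticeModels Literature.Probability.Percolation

/-! ## Real analysis at the wide scale -/

/-- **The two scales separate (wide box)**: for `A > 1`, eventually in `u : ℕ`, `1 ≤ u` and `72 u ≤ u^A`
(since `u^{A−1} → ∞`). [folklore] -/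
theorem eventually_one_le_and_seventyTwo_mul_le {A : ℝ} (hA : 1 < A) :
    ∀ᶠ u : ℕ in atTop, 1 ≤ u ∧ 72 * (u : ℝ) ≤ (u : ℝ) ^ A := by
  have hev : ∀ᶠ u : ℕ in atTop, (72 : ℝ) ≤ (u : ℝ) ^ (A - 1) :=
    ((tendsto_rpow_atTop (by linarith : 0 < A - 1)).comp tendsto_natCast_atTop_atTop).eventually_ge_atTop
      72
  filter_upwards [hev, eventually_ge_atTop 1] with u hu hu1
  refine ⟨hu1, ?_⟩
  have hU1 : (1 : ℝ) ≤ u := Nat.one_le_cast.2 hu1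
  have hU : (0 : ℝ) < u := by linarith
  have hsplit : (u : ℝ) ^ A = (u : ℝ) ^ (1 : ℝ) * (u : ℝ) ^ (A - 1) := by
    rw [← Real.rpow_add hU]; congr 1; ring
  rw [hsplit, Real.rpow_one]
  calc 72 * (u : ℝ) = (u : ℝ) * 72 := by ring
    _ ≤ (u : ℝ) * (u : ℝ) ^ (A - 1) := mul_le_mul_of_nonneg_left hu hU.le

/-- **Collecting the powers (wide box)** against the pair-connection lower bound `δ = c t^{-e}`:
`(36 · 3⁴ 7⁶ 3 · 2^κ q C / (c t^{−e})) · t⁴ (9t)⁶ (t^A)^{−κ} = (36 · 3⁴ 7⁶ 3 · 2^κ q C 9⁶ / c) · t^{10 + e − κA}`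
for `t > 0`. [folklore] -/
theorem collect_rpow_bdry_wide {t c e κ A q C : ℝ} (ht : 0 < t) :
    36 * 3 ^ 4 * 7 ^ 6 * 3 * 2 ^ κ * q * C / (c * t ^ (-e)) *
        (t ^ (4 : ℕ) * (9 * t) ^ (6 : ℕ) * (t ^ A) ^ (-κ)) =
      36 * 3 ^ 4 * 7 ^ 6 * 3 * 2 ^ κ * q * C * 9 ^ 6 / c * t ^ (10 + e - κ * A) := by
  have e1 : t ^ (-e) = (t ^ e)⁻¹ := Real.rpow_neg ht.le e
  have e2 : (t ^ A) ^ (-κ) = t ^ (-(κ * A)) := by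
    rw [← Real.rpow_mul ht.le]; congr 1; ring
  have e3 : t ^ (10 + e - κ * A) = t ^ (10 : ℕ) * t ^ e * t ^ (-(κ * A)) := by
    rw [sub_eq_add_neg, Real.rpow_add ht, Real.rpow_add ht]
    congr 2
    exact_mod_cast Real.rpow_natCast t 10
  rw [e1, e2, e3]
  simp only [div_eq_mul_inv, mul_inv, inv_inv]
  ring

end NearLinearTwoClusterDecayAspectBdryWide

open MeasureTheory Filter Topology
open Literature.Probability.LatticeModels Literature.Probability.Percolation
open NearLinearTwoClusterDecayAspectBdry NearLinearTwoClusterDecayAspectBdryWide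

/-- **Stub V6 `stub_aspectOfTwoArmBdryWide` of the line `pair-decay-long-arms-dense`** (registered; § Point-to-point
frontier, the lossy step at a general parameter with BOUNDARY pairs and the WIDE connection box): for bond
percolation on `ℤ³` at any `p > 0`, a pair-connection lower bound `P_p(a ↔ b inside Λ_{9n}) ≥ c n^{-e}` on `Λ_n²`
(`e ≥ 0`) and a two-arms exponent `κ` give two-cluster decay at every aspect exponent `A > 1` with `κ A > 10 + e` —
the crux event of `(Λ_n, Λ_N)` forces `twoArmsBox n (N − n) a b` for a pair `a, b ∈ ∂ⁱⁿΛ_n` (exit points), then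
Cerf 2015 Lemma 7.1 (bond) with middle box `Λ_{9n}` (`k = 8n`) and the count
`36 (2n+1)⁴ (1 + 6/p)(18n+3)⁶ · 3C (N − 9n − 2)^{−κ} / (c n^{−e}) ≤ K n^{10 + e − κA} → 0`.
[cite: Cerf2015, Lemma 7.1 and Cor 7.2] -/
theorem stub_aspectOfTwoArmBdryWide :
    ∀ p : unitInterval, 0 < (p : ℝ) → ∀ e : ℝ, 0 ≤ e →
    (∃ c : ℝ, 0 < c ∧ ∀ n : ℕ, 1 ≤ n → ∀ a ∈ box 3 n, ∀ b ∈ box 3 n,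
      c * (n : ℝ) ^ (-e) ≤
        (bondPercolation (zdGraph 3) p).real (openConnIn (↑(box 3 (9 * n)) : Set (Site 3)) a b)) →
    ∀ κ : ℝ, 0 < κ →
    (∃ C : ℝ, ∀ i : Fin 3, ∀ m : ℕ, 1 ≤ m →
      (bondPercolation (zdGraph 3) p).real (AKN.edgeTwoArms i m) ≤ C * (m : ℝ) ^ (-κ)) →
    ∀ A : ℝ, 1 < A → 10 + e < κ * A →
    Filter.Tendsto (fun n : ℕ => (bondPercolation (zdGraph 3) p).real
      {ω | ∃ x ∈ box 3 n, ∃ x' ∈ box 3 n, ∃ y ∈ innerBoundary (zdGraph 3) (box 3 ⌈(n : ℝ) ^ A⌉₊),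
        ∃ y' ∈ innerBoundary (zdGraph 3) (box 3 ⌈(n : ℝ) ^ A⌉₊),
          ω ∈ openConnIn ↑(box 3 ⌈(n : ℝ) ^ A⌉₊) x y ∧
          ω ∈ openConnIn ↑(box 3 ⌈(n : ℝ) ^ A⌉₊) x' y' ∧
          ω ∉ openConnIn ↑(box 3 ⌈(n : ℝ) ^ A⌉₊) x x'}) Filter.atTop (nhds 0) := by
  intro p hp0 e _he hW1 κ hκ hTA A hA1 hκA
  obtain ⟨c, hc, hW⟩ := hW1
  obtain ⟨C, hC⟩ := hTA
  have hC0 : 0 ≤ C := by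
    have h := hC 0 1 le_rfl
    rw [Nat.cast_one, Real.one_rpow, mul_one] at h
    exact measureReal_nonneg.trans h
  obtain ⟨q, hq⟩ : ∃ q : ℝ, q = 1 + 6 / (p : ℝ) := ⟨_, rfl⟩
  have hq0 : 0 ≤ q := by rw [hq]; positivity
  obtain ⟨K, hK⟩ : ∃ K : ℝ, K = 36 * 3 ^ 4 * 7 ^ 6 * 3 * 2 ^ κ * q * C * 9 ^ 6 / c := ⟨_, rfl⟩
  have hlim : Tendsto (fun n : ℕ => K * (n : ℝ) ^ (10 + e - κ * A)) atTop (𝓝 0) := by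
    have h1 : Tendsto (fun n : ℕ => (n : ℝ) ^ (10 + e - κ * A)) atTop (𝓝 0) := by
      have e' : 10 + e - κ * A = -(κ * A - 10 - e) := by ring
      rw [e']
      exact (tendsto_rpow_neg_atTop (by linarith)).comp tendsto_natCast_atTop_atTop
    simpa only [mul_zero] using h1.const_mul K
  refine squeeze_zero' (Eventually.of_forall fun n => measureReal_nonneg) ?_ hlim
  -- at a good scale `n` (`1 ≤ n`, `72 n ≤ n^A ≤ N`), whence `9n + 3 ≤ N` and `N − 9n − 2 ≥ n^A / 2`
  filter_upwards [eventually_one_le_and_seventyTwo_mul_le hA1] with n ⟨hn1, h72⟩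
  have hU1 : (1 : ℝ) ≤ n := Nat.one_le_cast.2 hn1
  have hU0 : (0 : ℝ) < n := by linarith
  have hδ : 0 < c * (n : ℝ) ^ (-e) := mul_pos hc (Real.rpow_pos_of_pos hU0 _)
  have hmr : ((9 * n : ℕ) : ℝ) = 9 * (n : ℝ) := by push_cast; ring
  have hM1 : (n : ℝ) ^ A ≤ (⌈(n : ℝ) ^ A⌉₊ : ℕ) := Nat.le_ceil _
  have hmM : 9 * n + 3 ≤ ⌈(n : ℝ) ^ A⌉₊ := by
    have h : ((9 * n : ℕ) : ℝ) + 3 ≤ (⌈(n : ℝ) ^ A⌉₊ : ℕ) := by rw [hmr]; linarith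
    exact_mod_cast h
  calc (bondPercolation (zdGraph 3) p).real
        {ω | ∃ x ∈ box 3 n, ∃ x' ∈ box 3 n, ∃ y ∈ innerBoundary (zdGraph 3) (box 3 ⌈(n : ℝ) ^ A⌉₊),
          ∃ y' ∈ innerBoundary (zdGraph 3) (box 3 ⌈(n : ℝ) ^ A⌉₊),
            ω ∈ openConnIn ↑(box 3 ⌈(n : ℝ) ^ A⌉₊) x y ∧
            ω ∈ openConnIn ↑(box 3 ⌈(n : ℝ) ^ A⌉₊) x' y' ∧
            ω ∉ openConnIn ↑(box 3 ⌈(n : ℝ) ^ A⌉₊) x x'}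
      ≤ 36 * (2 * (n : ℝ) + 1) ^ 4 * ((1 + 6 / (p : ℝ)) *
          (2 * ((9 * n : ℕ) : ℝ) + 3) ^ 6 *
            (3 * C * (((⌈(n : ℝ) ^ A⌉₊ : ℕ) : ℝ) - ((9 * n : ℕ) : ℝ) - 2) ^ (-κ))) /
          (c * (n : ℝ) ^ (-e)) :=
        real_twoCluster_le_poly p hp0 hδ hC (by omega) hmM (hW n hn1)
    _ ≤ 36 * 3 ^ 4 * 7 ^ 6 * 3 * 2 ^ κ * q * C / (c * (n : ℝ) ^ (-e)) *
          ((n : ℝ) ^ (4 : ℕ) * (9 * (n : ℝ)) ^ (6 : ℕ) * ((n : ℝ) ^ A) ^ (-κ)) := by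
        rw [hq]
        exact poly_bound_bdry hU1 (by linarith) hmr.ge (by rw [hmr]; linarith) hM1 (by linarith)
          (hq ▸ hq0) hC0 hδ hκ.le
    _ = K * (n : ℝ) ^ (10 + e - κ * A) := by rw [hK]; exact collect_rpow_bdry_wide hU0

end Summit.CriticalPhenomena.PercolationContinuityZ3.Theorems
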